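import Summits.ResolutionOfSingularities.ResolutionOfSingularities.Theorems.HomologicalConductorNoZenoH0LeResidueDegree
import Literature.AlgebraicGeometry.Motives.SteinFactorizationCurve
import HarnessLib

/-!
# Crux `NoZenoR` (stmt-ResolutionOfSingularities-19943), slot 5 (B1) `stub_L1wCoreF3`, seam2 ROUTE M:
# the CONSTANT FIELD of a NORMAL exceptional curve — `h⁰(E′) ≤ h⁰(E)` for any curve `E′` upstairs mapping onto it

OURS (cell res-hironaka, crux chain W4.4, lead res-L0-w44-lead-1 gen 9); nothing here is a statement of the manuscript
under review (Hironaka 2017); AI-written, weaker than expert review.  SUPPORT-level, counted 0.  Def-free, FACT-FREE.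

THE STATEMENT (`h0_le_h0_of_forall_isIntegrallyClosed_stalk`).  `π : X → Spec S` and `g ≫ π : X′ → Spec S` proper (`S`
Noetherian; locality and integrality of `X`, `X′` are not needed), `η′ ∈ X′` a point at which the stalk map `g♯_{η′} : 𝒪_{X, g η′} → 𝒪_{X′, η′}` is
BIJECTIVE (e.g. `g` birational and `𝒪_{X, g η′}` a valuation ring — pv-045 `stalkMap_bijective_of_isBirational`), and every
local ring of the integral curve `E := ClosedSubvariety.ofPoint X (g η′)` integrally closed (E NORMAL).  Then
`h0 (g ≫ π) 𝓘_{η′} ≤ h0 π 𝓘_{g η′}`, i.e. `h⁰(𝒪_{E′}) ≤ h⁰(𝒪_E)` for `E′ := ClosedSubvariety.ofPoint X′ η′`.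

THE PROOF.  `Γ(E′, 𝒪)` is module-finite over `S`; its generic values, transported along
`K(E′) = κ(ξ′) ≅ κ_{X′}(η′) ≅ κ_X(g η′) ≅ κ(ξ) = K(E)` (residue fields at the generic points; the middle map is
`g.residueFieldMap`, bijective by hypothesis; the outer ones are the residue-field maps of the closed immersions `E ↪ X`,
`E′ ↪ X′`), are elements of `K(E)` integral over `S`, hence over `Γ(E, 𝒪)`, hence — `E` being normal — global sections of `E`
(`exists_germToFunctionField_eq_of_isIntegral_of_isIntegrallyClosed_stalk`).  This is an injective `S`-linear map
`Γ(E′, 𝒪) → Γ(E, 𝒪)`, so `length_S Γ(E′, 𝒪) ≤ length_S Γ(E, 𝒪)`.  The `S`-compatibility of the transport is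
`Γevaluation_naturality` + `residueFieldMap_comp`.

CONSUMER: with `caseA_of_firstKind` (p568621: Case A ⇒ `h⁰(E) < h⁰(E′)`) and `forall_isIntegrallyClosed_stalk_ofPoint`
(Case A + `E′` regular ⇒ `E` normal) this shows that a REGULAR first-kind curve upstairs is never mapped ONTO a curve
satisfying (M) — node curves are contracted by `W → Y_min`.

References: Q. Liu, *Algebraic Geometry and Arithmetic Curves* (2002), Cor. 3.3.21, Def. 4.1.24 [`Liu2002`];
J. Lipman, Publ. Math. IHÉS 36 (1969) §10 (p. 212) [`Lipman1969`] (context: `h⁰` = degree of the field of constants).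
-/

noncomputable section

-- single-problem summit: the doubled namespace component `ResolutionOfSingularities` is forced
set_option linter.dupNamespace false

namespace Summit.ResolutionOfSingularities.ResolutionOfSingularities.Theorems.NoZeno.ExcCount

open CategoryTheory AlgebraicGeometry TopologicalSpace IsLocalRing Opposite
open Literature.AlgebraicGeometry.Resolution Literature.AlgebraicGeometry.Motives
open Literature.AlgebraicGeometry.Morphisms

/-! ## §1 Residue-field maps: surjectivity and bijectivity -/

section Residue

/-- A morphism with surjective stalk map at `x` has surjective residue-field map at `x`. [folklore] -/
theorem residueFieldMap_surjective_of_stalkMap_surjective {X Y : Scheme.{0}} (f : X ⟶ Y) (x : X)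
    (h : Function.Surjective (f.stalkMap x)) : Function.Surjective (f.residueFieldMap x) := by
  intro r
  obtain ⟨t, rfl⟩ := X.residue_surjective x r
  obtain ⟨s, rfl⟩ := h t
  refine ⟨Y.residue _ s, ?_⟩
  rw [← CommRingCat.comp_apply, Scheme.residue_residueFieldMap, CommRingCat.comp_apply]

/-- … hence bijective (a ring homomorphism out of a field is injective). [folklore] -/
theorem residueFieldMap_bijective_of_stalkMap_surjective {X Y : Scheme.{0}} (f : X ⟶ Y) (x : X)
    (h : Function.Surjective (f.stalkMap x)) : Function.Bijective (f.residueFieldMap x) :=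
  ⟨(f.residueFieldMap x).hom.injective, residueFieldMap_surjective_of_stalkMap_surjective f x h⟩

/-- The residue map at the generic point of an integral scheme is bijective (the stalk is the function field).
[folklore] -/
theorem residue_genericPoint_bijective (E : Scheme.{0}) [IsIntegral E] :
    Function.Bijective (E.residue (genericPoint E)) := by
  refine ⟨?_, E.residue_surjective _⟩
  have hbot : maximalIdeal (E.presheaf.stalk (genericPoint E)) = ⊥ :=
    (IsLocalRing.isField_iff_maximalIdeal_eq).mp (Field.toIsField E.functionField)
  rw [injective_iff_map_eq_zero]
  intro a ha
  have : a ∈ maximalIdeal (E.presheaf.stalk (genericPoint E)) := by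
    rw [← IsLocalRing.residue_eq_zero_iff]
    exact ha
  rwa [hbot, Ideal.mem_bot] at this

/-- `(RingEquiv.ofBijective f hf)⁻¹ (f x) = x`. [folklore] -/
theorem ringEquiv_ofBijective_symm_apply_apply {R T : Type*} [NonAssocSemiring R] [NonAssocSemiring T]
    (f : R →+* T) (hf : Function.Bijective f) (x : R) : (RingEquiv.ofBijective f hf).symm (f x) = x :=
  (RingEquiv.ofBijective f hf).injective (by rw [RingEquiv.apply_symm_apply]; rfl)

end Residue

/-! ## §2 `h⁰(E′) ≤ h⁰(E)` for `E` normal -/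

section ConstantField

variable {S : Type} [CommRing S] [IsNoetherianRing S] {X X' : Scheme.{0}} (π : X ⟶ Spec (.of S)) (g : X' ⟶ X)

/-- **`h⁰(E′) ≤ h⁰(E)` when `E` is normal and `g♯` is bijective at the generic point of `E′`.**  See the module
docstring. [cite: Liu2002, Corollary 3.3.21] -/
theorem h0_le_h0_of_forall_isIntegrallyClosed_stalk [IsProper π] [IsProper (g ≫ π)] (η' : X')
    (hbij : Function.Bijective (g.stalkMap η'))
    (hnorm : ∀ y : (ClosedSubvariety.ofPoint X (g.base η')).carrier,
      IsIntegrallyClosed ((ClosedSubvariety.ofPoint X (g.base η')).carrier.presheaf.stalk y)) :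
    h0 (g ≫ π) (primeDivisorIdeal η') ≤ h0 π (primeDivisorIdeal (g.base η')) := by
  -- the two integral curves and their generic points
  set E := ClosedSubvariety.ofPoint X (g.base η') with hEdef
  set E' := ClosedSubvariety.ofPoint X' η' with hE'def
  set ξ : E.carrier := genericPoint E.carrier with hξdef
  set ξ' : E'.carrier := genericPoint E'.carrier with hξ'def
  have hξ : E.ι.base ξ = g.base η' := ClosedSubvariety.genericPoint_ofPoint (X := X) (g.base η')
  have hξ' : E'.ι.base ξ' = η' := ClosedSubvariety.genericPoint_ofPoint (X := X') η'
  have e₀ : g.base (E'.ι.base ξ') = E.ι.base ξ := by rw [hξ', hξ]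
  -- the sections modules
  rw [h0_primeDivisorIdeal_eq, h0_primeDivisorIdeal_eq]
  change Module.length S (Sections (E'.ι ≫ g ≫ π) ⊤) ≤ Module.length S (Sections (E.ι ≫ π) ⊤)
  haveI : Module.Finite S (Sections (E'.ι ≫ g ≫ π) ⊤) := moduleFinite_sections_top_of_isProper _
  -- (1) the residue-field isomorphisms at the generic points
  --   a  : κ_X(E.ι ξ) ≅ κ_E(ξ),  a′ : κ_{X′}(E′.ι ξ′) ≅ κ_{E′}(ξ′)  (closed immersions)
  have ha : Function.Bijective (E.ι.residueFieldMap ξ) :=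
    residueFieldMap_bijective_of_stalkMap_surjective E.ι ξ (E.ι.stalkMap_surjective ξ)
  have ha' : Function.Bijective (E'.ι.residueFieldMap ξ') :=
    residueFieldMap_bijective_of_stalkMap_surjective E'.ι ξ' (E'.ι.stalkMap_surjective ξ')
  --   b : κ_X(g (E′.ι ξ′)) ≅ κ_{X′}(E′.ι ξ′)  (bijective stalk map, transported from `η′`)
  have hbij' : Function.Bijective (g.stalkMap (E'.ι.base ξ')) := by
    have : ∀ x' : X', x' = η' → Function.Bijective (g.stalkMap x') := by
      rintro x' rfl; exact hbij
    exact this _ hξ'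
  have hb : Function.Bijective (g.residueFieldMap (E'.ι.base ξ')) :=
    residueFieldMap_bijective_of_stalkMap_surjective g _ hbij'.2
  --   r, r′ : the residue maps at the generic points (function field ≅ residue field)
  have hr : Function.Bijective (E.carrier.residue ξ) := residue_genericPoint_bijective E.carrier
  have hr' : Function.Bijective (E'.carrier.residue ξ') := residue_genericPoint_bijective E'.carrier
  let A : X.residueField (E.ι.base ξ) ≃+* E.carrier.residueField ξ := RingEquiv.ofBijective (E.ι.residueFieldMap ξ).hom ha
  let A' : X'.residueField (E'.ι.base ξ') ≃+* E'.carrier.residueField ξ' :=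
    RingEquiv.ofBijective (E'.ι.residueFieldMap ξ').hom ha'
  let B : X.residueField (g.base (E'.ι.base ξ')) ≃+* X'.residueField (E'.ι.base ξ') :=
    RingEquiv.ofBijective (g.residueFieldMap (E'.ι.base ξ')).hom hb
  let C : X.residueField (g.base (E'.ι.base ξ')) ≃+* X.residueField (E.ι.base ξ) :=
    (X.residueFieldCongr e₀).commRingCatIsoToRingEquiv
  let R : E.carrier.functionField ≃+* E.carrier.residueField ξ := RingEquiv.ofBijective (E.carrier.residue ξ).hom hr
  let R' : E'.carrier.functionField ≃+* E'.carrier.residueField ξ' :=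
    RingEquiv.ofBijective (E'.carrier.residue ξ').hom hr'
  -- the transport `θ : K(E′) ≃ K(E)`
  let θ : E'.carrier.functionField ≃+* E.carrier.functionField :=
    (((R'.trans A'.symm).trans B.symm).trans C).trans (A.trans R.symm)
  -- (2) the structure maps `S → κ(ξ)`, `S → κ(ξ′)` and their compatibility with `Γevaluation`
  let φ₀ : S →+* (Spec (.of S)).residueField ((E.ι ≫ π).base ξ) :=
    ((Scheme.ΓSpecIso (.of S)).inv ≫ (Spec (.of S)).Γevaluation ((E.ι ≫ π).base ξ)).hom
  let φ₀' : S →+* (Spec (.of S)).residueField ((E'.ι ≫ g ≫ π).base ξ') :=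
    ((Scheme.ΓSpecIso (.of S)).inv ≫ (Spec (.of S)).Γevaluation ((E'.ι ≫ g ≫ π).base ξ')).hom
  have hcompat : ∀ s : S, (E.carrier.Γevaluation ξ).hom (algebraMap S (Sections (E.ι ≫ π) ⊤) s) =
      ((E.ι ≫ π).residueFieldMap ξ).hom (φ₀ s) := by
    intro s
    rw [algebraMap_sections_ofPoint_apply]
    exact (Scheme.Γevaluation_naturality_apply (E.ι ≫ π) ξ ((Scheme.ΓSpecIso (.of S)).inv s)).symm
  have hcompat' : ∀ s : S, (E'.carrier.Γevaluation ξ').hom (algebraMap S (Sections (E'.ι ≫ g ≫ π) ⊤) s) =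
      ((E'.ι ≫ g ≫ π).residueFieldMap ξ').hom (φ₀' s) := by
    intro s
    have h := algebraMap_sections_ofPoint_apply (g ≫ π) η' s
    rw [h]
    exact (Scheme.Γevaluation_naturality_apply (E'.ι ≫ g ≫ π) ξ' ((Scheme.ΓSpecIso (.of S)).inv s)).symm
  -- the key compatibility: the chain `A ∘ C ∘ B⁻¹ ∘ A′⁻¹` carries `S → κ(ξ′)` to `S → κ(ξ)`
  have hkey : ∀ s : S, A (C (B.symm (A'.symm (((E'.ι ≫ g ≫ π).residueFieldMap ξ').hom (φ₀' s))))) =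
      ((E.ι ≫ π).residueFieldMap ξ).hom (φ₀ s) := by
    intro s
    -- unfold the composite residue-field maps
    have h1 : ((E'.ι ≫ g ≫ π).residueFieldMap ξ').hom (φ₀' s) =
        (E'.ι.residueFieldMap ξ').hom ((g.residueFieldMap (E'.ι.base ξ')).hom
          ((π.residueFieldMap (g.base (E'.ι.base ξ'))).hom (φ₀' s))) := by
      rw [Scheme.residueFieldMap_comp, Scheme.residueFieldMap_comp]
      rfl
    have h2 : ((E.ι ≫ π).residueFieldMap ξ).hom (φ₀ s) =
        (E.ι.residueFieldMap ξ).hom ((π.residueFieldMap (E.ι.base ξ)).hom (φ₀ s)) := by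
      rw [Scheme.residueFieldMap_comp]
      rfl
    rw [h1, h2]
    -- peel `A′` and `B`
    have hA' : A'.symm ((E'.ι.residueFieldMap ξ').hom ((g.residueFieldMap (E'.ι.base ξ')).hom
          ((π.residueFieldMap (g.base (E'.ι.base ξ'))).hom (φ₀' s)))) =
        (g.residueFieldMap (E'.ι.base ξ')).hom ((π.residueFieldMap (g.base (E'.ι.base ξ'))).hom (φ₀' s)) :=
      ringEquiv_ofBijective_symm_apply_apply _ ha' _
    rw [hA']
    have hB : B.symm ((g.residueFieldMap (E'.ι.base ξ')).hom ((π.residueFieldMap (g.base (E'.ι.base ξ'))).hom (φ₀' s))) =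
        (π.residueFieldMap (g.base (E'.ι.base ξ'))).hom (φ₀' s) :=
      ringEquiv_ofBijective_symm_apply_apply _ hb _
    rw [hB]
    -- transport along `e₀ : g (E′.ι ξ′) = E.ι ξ`
    have hC : C ((π.residueFieldMap (g.base (E'.ι.base ξ'))).hom (φ₀' s)) =
        (π.residueFieldMap (E.ι.base ξ)).hom (φ₀ s) := by
      change ((π.residueFieldMap (g.base (E'.ι.base ξ'))) ≫ (X.residueFieldCongr e₀).hom).hom (φ₀' s) = _
      rw [Scheme.Hom.residueFieldMap_congr' (f := π) e₀]
      change ((π.residueFieldMap (E.ι.base ξ))).hom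
        ((((Scheme.ΓSpecIso (.of S)).inv ≫ (Spec (.of S)).Γevaluation ((E'.ι ≫ g ≫ π).base ξ')) ≫
          ((Spec (CommRingCat.of S)).residueFieldCongr (congrArg π.base e₀)).hom).hom s) = _
      have hΓc : ∀ {p q : ↥(Spec (CommRingCat.of S))} (e : p = q),
          (Spec (CommRingCat.of S)).Γevaluation p ≫ ((Spec (CommRingCat.of S)).residueFieldCongr e).hom =
            (Spec (CommRingCat.of S)).Γevaluation q := by
        intro p q e; subst e; simp [Scheme.residueFieldCongr_refl]
      have key2 : (Scheme.ΓSpecIso (.of S)).inv ≫ (Spec (.of S)).Γevaluation ((E'.ι ≫ g ≫ π).base ξ') ≫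
          ((Spec (CommRingCat.of S)).residueFieldCongr (congrArg π.base e₀)).hom =
          (Scheme.ΓSpecIso (.of S)).inv ≫ (Spec (.of S)).Γevaluation ((E.ι ≫ π).base ξ) :=
        congrArg (fun t => (Scheme.ΓSpecIso (.of S)).inv ≫ t) (hΓc (congrArg π.base e₀))
      rw [Category.assoc, key2]
      rfl
    rw [hC]
    rfl
  -- (3) the transport `ψ := θ ∘ germ′ : Γ(E′) → K(E)` is compatible with `germ ∘ algebraMap`
  haveI : Nonempty (⊤ : E.carrier.Opens) := ⟨⟨ξ, trivial⟩⟩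
  haveI : Nonempty (⊤ : E'.carrier.Opens) := ⟨⟨ξ', trivial⟩⟩
  -- (as ring maps on the type synonyms `Sections`, so that `map_add`/`map_mul` see the right structure)
  let germE : Sections (E.ι ≫ π) ⊤ →+* E.carrier.functionField :=
    (E.carrier.germToFunctionField ⊤).hom.comp (Sections.equiv (E.ι ≫ π) ⊤).toRingHom
  let ψ : Sections (E'.ι ≫ g ≫ π) ⊤ →+* E.carrier.functionField :=
    θ.toRingHom.comp ((E'.carrier.germToFunctionField ⊤).hom.comp (Sections.equiv (E'.ι ≫ g ≫ π) ⊤).toRingHom)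
  have hgermE : ∀ γ, germE γ = E.carrier.germToFunctionField ⊤ γ := fun _ => rfl
  have hψdef : ∀ γ', ψ γ' = θ (E'.carrier.germToFunctionField ⊤ γ') := fun _ => rfl
  have hΓev : ∀ γ : Γ(E.carrier, ⊤), (E.carrier.Γevaluation ξ).hom γ = R (E.carrier.germToFunctionField ⊤ γ) := by
    intro γ; rfl
  have hΓev' : ∀ γ : Γ(E'.carrier, ⊤), (E'.carrier.Γevaluation ξ').hom γ = R' (E'.carrier.germToFunctionField ⊤ γ) := by
    intro γ; rfl
  have hψ : ∀ s : S, ψ (algebraMap S (Sections (E'.ι ≫ g ≫ π) ⊤) s) = germE (algebraMap S (Sections (E.ι ≫ π) ⊤) s) := by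
    intro s
    rw [hgermE, hψdef]
    apply R.injective
    change R (R.symm (A (C (B.symm (A'.symm (R' (E'.carrier.germToFunctionField ⊤
      (algebraMap S (Sections (E'.ι ≫ g ≫ π) ⊤) s)))))))) = _
    rw [R.apply_symm_apply, ← hΓev', hcompat', hkey, ← hcompat, hΓev]
  -- (4) every generic value of `Γ(E′)`, transported, is the germ of a section of `E`
  have hsec : ∀ γ' : Sections (E'.ι ≫ g ≫ π) ⊤, ∃ γ : Sections (E.ι ≫ π) ⊤, germE γ = ψ γ' := by
    intro γ'
    -- `γ′` is integral over `S`; push the equation through `ψ`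
    have hint : IsIntegral S γ' := Algebra.IsIntegral.isIntegral γ'
    obtain ⟨p, hp, hpγ⟩ := hint
    have hf : IsIntegral Γ(E.carrier, ⊤) (ψ γ') := by
      refine ⟨p.map (algebraMap S (Sections (E.ι ≫ π) ⊤)), hp.map _, ?_⟩
      rw [Polynomial.eval₂_map]
      have hcomp : (algebraMap Γ(E.carrier, ⊤) E.carrier.functionField).comp (algebraMap S (Sections (E.ι ≫ π) ⊤)) =
          ψ.comp (algebraMap S (Sections (E'.ι ≫ g ≫ π) ⊤)) := by
        ext s
        exact (hψ s).symm
      rw [hcomp, ← Polynomial.hom_eval₂, hpγ, map_zero]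
    obtain ⟨γ, hγ⟩ := exists_germToFunctionField_eq_of_isIntegral_of_isIntegrallyClosed_stalk hnorm ⊤ hf
    exact ⟨γ, hγ⟩
  choose Φ hΦ using hsec
  -- (5) `Φ` is an injective `S`-linear map `Γ(E′) → Γ(E)`
  have hinjE : Function.Injective germE := E.carrier.germToFunctionField_injective ⊤
  let ΦL : Sections (E'.ι ≫ g ≫ π) ⊤ →ₗ[S] Sections (E.ι ≫ π) ⊤ :=
    { toFun := Φ
      map_add' := fun a b => by
        apply hinjE
        rw [map_add, hΦ, hΦ, hΦ, map_add]
      map_smul' := fun s a => by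
        apply hinjE
        change germE (Φ (s • a)) = germE (s • Φ a)
        rw [Algebra.smul_def, Algebra.smul_def, hΦ, map_mul, map_mul, hψ, hΦ] }
  have hinj : Function.Injective ΦL := by
    intro a b hab
    have h : ψ a = ψ b := by
      rw [← hΦ, ← hΦ]
      exact congrArg _ hab
    exact (E'.carrier.germToFunctionField_injective ⊤) (θ.injective h)
  exact Module.length_le_of_injective ΦL hinj

end ConstantField

end Summit.ResolutionOfSingularities.ResolutionOfSingularities.Theorems.NoZeno.ExcCount

end
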